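import Literature.NumberTheory.EllipticCurves.LocalRestrictionDegree
import Literature.NumberTheory.EllipticCurves.SelmerGaloisAction
import Mathlib.LinearAlgebra.Complex.FiniteDimensional
import HarnessLib

/-!
# At an archimedean place the local condition holds after multiplication by `2`

For a Weierstrass curve `W` (an elliptic curve `E`) over a number field `K` and an infinite place
`w` of `K`, every class `x ∈ H¹(K, E)` satisfies `2x ↦ 0` in `H¹(K_w, E)`: if `w` is complex,
`K_w ≅ ℂ` is algebraically closed and `H¹(K_w, ·) = 0` (Gross 1991, proof of Prop. 6.2 (1));
if `w` is real, `K_w ≅ ℝ ⊂ ℂ` is a tower with `[ℂ : K_w] = 2`, every class dies over `ℂ`, hence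
`2x` dies over `K_w` (`two_nsmul_mem_localRestrictionKer_of_tower`, i.e. `H¹(ℝ, ·)` is killed by
`|Gal(ℂ/ℝ)| = 2`). Consequences for the `p^∞`-Selmer local conditions at infinite places
(`two_nsmul_mem_selmerLocalKerPrimary_infinitePlace`).

The number field is taken in `Type` (universe `0`), as in the statements this serves
(`Literature.NumberTheory.EllipticCurves.selmerCorank_baseChange_quadratic`), because the
auxiliary tower uses Mathlib's `ℂ : Type`. Everything here is proved.

## References

* B. H. Gross, *Kolyvagin's work on modular elliptic curves*, LMS LNS 153 (1991), §6, proof of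
  Prop. 6.2 (1). [GrossLMS1991]
* J.-P. Serre, *Galois Cohomology* (1997), I.§2.4. [SerreGaloisCohomology1997]
-/

noncomputable section

open scoped Classical

namespace Literature.NumberTheory.EllipticCurves

open GaloisRepresentations WeierstrassCurve NumberField

section AlgClosed

variable {K : Type} [Field K] (W : WeierstrassCurve K) (E : Type) [Field E] [Algebra K E]

/-- Over a `K`-field with trivial absolute Galois group every class of `H¹(K, E)` dies in
`H¹(E, E)`: `localRestrictionKer W E = ⊤` (the `H¹(·, E)` version of the tree's
`selmerLocalKer_eq_top_of_subsingleton`). [cite: GrossLMS1991, §6 (proof of Prop. 6.2 (1))] -/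
theorem localRestrictionKer_eq_top_of_subsingleton [Subsingleton (Field.absoluteGaloisGroup E)] :
    W.localRestrictionKer E = ⊤ := by
  rw [eq_top_iff]
  intro c _
  obtain ⟨f, rfl⟩ := oneCocycleClass_surjective _ c
  rw [localRestrictionKer, oneCocycleClass_mem_resKer_iff]
  refine ⟨0, fun x ↦ ?_⟩
  rw [Subsingleton.elim x 1, map_one, contOneCocycles.apply_one, map_zero, smul_zero, sub_zero]

/-- `localRestrictionKer W E = ⊤` at an algebraically closed `K`-field `E`. [folklore] -/
theorem localRestrictionKer_eq_top_of_isAlgClosed [IsAlgClosed E] : W.localRestrictionKer E = ⊤ :=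
  haveI := subsingleton_absoluteGaloisGroup_of_isAlgClosed E
  localRestrictionKer_eq_top_of_subsingleton W E

end AlgClosed

section Archimedean

variable {K : Type} [Field K] [NumberField K] (W : WeierstrassCurve K)

/-- **At an infinite place the local condition holds up to `2`**: for every `x ∈ H¹(K, E)` and
every infinite place `w` of `K`, `2x ↦ 0` in `H¹(K_w, E)`. Complex `w`: `K_w ≅ ℂ` is
algebraically closed. Real `w`: `K_w ≅ ℝ`, and `ℂ` is a `K_w`-field of degree `2` over which `x`
dies, so `2x` dies over `K_w` (`two_nsmul_mem_localRestrictionKer_of_tower`).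
Serre, *Galois Cohomology*, I.§2.4 (Cor. to Prop. 9: `H¹(ℝ, ·)` is killed by `2`).
[cite: SerreGaloisCohomology1997, I.§2.4 Cor. to Prop. 9] -/
theorem two_nsmul_mem_localRestrictionKer_infinitePlace (w : InfinitePlace K) (x : W.galH1) :
    2 • x ∈ W.localRestrictionKer w.Completion := by
  rcases w.isReal_or_isComplex with hw | hw
  · -- real place: the tower `K → K_w → ℂ`
    let e : w.Completion ≃+* ℝ := InfinitePlace.Completion.ringEquivRealOfIsReal hw
    letI : Algebra w.Completion ℂ := (Complex.ofRealHom.comp e.toRingHom).toAlgebra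
    letI : Algebra K ℂ := ((algebraMap w.Completion ℂ).comp (algebraMap K w.Completion)).toAlgebra
    haveI : IsScalarTower K w.Completion ℂ := IsScalarTower.of_algebraMap_eq fun _ ↦ rfl
    have hrank : Module.finrank w.Completion ℂ = 2 := by
      rw [Algebra.finrank_eq_of_equiv_equiv e (RingEquiv.refl ℂ) (by ext; rfl),
        Complex.finrank_real_complex]
    haveI : FiniteDimensional w.Completion ℂ :=
      Module.finite_of_finrank_pos (by rw [hrank]; exact two_pos)
    haveI : CharZero w.Completion :=
      charZero_of_injective_algebraMap (algebraMap K w.Completion).injective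
    have hx : x ∈ W.localRestrictionKer ℂ := by
      rw [localRestrictionKer_eq_top_of_isAlgClosed]; trivial
    exact two_nsmul_mem_localRestrictionKer_of_tower W (E := w.Completion) hrank.le hx
  · -- complex place
    haveI : IsAlgClosed w.Completion :=
      isAlgClosed_of_ringEquiv (InfinitePlace.Completion.ringEquivComplexOfIsComplex hw).symm
    rw [localRestrictionKer_eq_top_of_isAlgClosed]
    trivial

/-- The `p^∞`-Selmer local condition at an infinite place holds up to `2`: for every
`η ∈ H¹(K, E[p^∞])` and every infinite place `w`, `2η ∈ selmerLocalKerPrimary W K_w p` (the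
condition is the preimage of the `H¹(·, E)` condition, `selmerLocalKerPrimary_eq_comap`).
[cite: SerreGaloisCohomology1997, I.§2.4 Cor. to Prop. 9] -/
theorem two_nsmul_mem_selmerLocalKerPrimary_infinitePlace (p : ℕ) (w : InfinitePlace K)
    (η : galH1Primary W p) : 2 • η ∈ selmerLocalKerPrimary W w.Completion p := by
  rw [selmerLocalKerPrimary_eq_comap, AddSubgroup.mem_comap, map_nsmul]
  exact two_nsmul_mem_localRestrictionKer_infinitePlace W w _

end Archimedean

end Literature.NumberTheory.EllipticCurves
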